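import Literature.Analysis.UnboundedOperators.LinearizedBoltzmannKernelActionPointwise
import Literature.MathematicalPhysics.KineticTheory.TaggedSphereGainCompact
import HarnessLib

/-!
# Continuity of the Carleman gain for functions of Gaussian growth in `ℝ³`

For the Carleman form `∫ k(v, x) ψ(v + x) dx` (`KineticTheory.carlemanGain 1`, BGSR/Hilbert kernel
`KineticTheory.carlemanKernel 1`) of the first gain term of the linearised hard-sphere operator in
`ℝ³` and a measurable `ψ` with the Gaussian growth `|ψ(x)| ≤ C e^{|x|²/4}` we prove that
`v ↦ ∫ k(v, x) ψ(v + x) dx` is continuous (`continuous_carlemanGain_of_gaussGrowth`): by Grad's bound,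
`k(v, x) |ψ(v + x)| ≤ C e^{|v|²/4} G(x)` with `G ∈ L¹(ℝ³)` (`integrable_carlemanKernel_mul_of_gaussGrowth`);
in the variable `y = v + x` the singularity `~|y - v|⁻¹` of the kernel moves with `v`, its
contribution near `v₀` is uniformly small (`abs_setIntegral_ball_carleman_le` and
`tendsto_setIntegral_gradRadial`), and away from `v₀` dominated convergence applies
(`continuousAt_setIntegral_compl_ball_carleman`). This is the continuity half of the classical
statement that `K` maps into continuous functions (CIP 1994 §7.2 Thm 7.2.3, Grad 1963), at the
Gaussian-growth level needed for the continuous representative of `L⁻¹ g`. No new definitions.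
-/

open MeasureTheory Metric Real Set Filter Topology ProbabilityTheory Module
open scoped InnerProductSpace ENNReal

namespace Literature.Analysis.UnboundedOperators

noncomputable section

open Literature.MathematicalPhysics.KineticTheory (collide sphereMeasure hardSphereKernel carlemanKernel
  gradRadial carlemanKernel_nonneg gradRadial_nonneg carlemanGain measurable_carlemanKernel
  tendsto_setIntegral_gradRadial integrable_gradRadial)
open Literature.Analysis.FluidPDE

/-! ### Gaussian-growth bounds on the Carleman kernel in `ℝ³` -/

/-- `√M(y) e^{|y|²/4} = √M(0)`. [folklore] -/
theorem sqrt_globalMaxwellian_mul_exp (y : EuclideanSpace ℝ (Fin 3)) :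
    Real.sqrt (globalMaxwellian y) * Real.exp (‖y‖ ^ 2 / 4) =
      Real.sqrt (globalMaxwellian (0 : EuclideanSpace ℝ (Fin 3))) := by
  have h := inv_sqrt_globalMaxwellian y
  have hy : 0 < Real.sqrt (globalMaxwellian y) := Real.sqrt_pos.2 (globalMaxwellian_pos y)
  have h0 : 0 < Real.sqrt (globalMaxwellian (0 : EuclideanSpace ℝ (Fin 3))) :=
    Real.sqrt_pos.2 (globalMaxwellian_pos 0)
  field_simp at h
  linarith [h]

/-- `M(y) ≤ M(0)`. [folklore] -/
theorem globalMaxwellian_le_zero (y : EuclideanSpace ℝ (Fin 3)) :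
    globalMaxwellian y ≤ globalMaxwellian (0 : EuclideanSpace ℝ (Fin 3)) := by
  simp only [globalMaxwellian, norm_zero]
  refine mul_le_mul_of_nonneg_left (Real.exp_le_exp.2 ?_) (by positivity)
  nlinarith [sq_nonneg ‖y‖]

/-- `k(v, x) ≤ e^{|v|²/4} G(x)` in `ℝ³` (Grad's bound and `M(v + x) ≤ M(0)`). [folklore] -/
theorem carlemanKernel_one_le_exp_mul_gradRadial (v x : EuclideanSpace ℝ (Fin 3)) :
    carlemanKernel 1 v x ≤ Real.exp (‖v‖ ^ 2 / 4) * gradRadial 1 x := by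
  have h := carlemanKernel_one_le v x
  have h0 : 0 < Real.sqrt (globalMaxwellian (0 : EuclideanSpace ℝ (Fin 3))) :=
    Real.sqrt_pos.2 (globalMaxwellian_pos 0)
  have hM : Real.sqrt (globalMaxwellian (v + x)) ≤ Real.sqrt (globalMaxwellian (0 : EuclideanSpace ℝ (Fin 3))) :=
    Real.sqrt_le_sqrt (globalMaxwellian_le_zero _)
  rw [inv_sqrt_globalMaxwellian v] at h
  calc carlemanKernel 1 v x
      ≤ (Real.sqrt (globalMaxwellian (0 : EuclideanSpace ℝ (Fin 3))))⁻¹ * Real.exp (‖v‖ ^ 2 / 4) *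
          gradRadial 1 x * Real.sqrt (globalMaxwellian (v + x)) := h
    _ ≤ (Real.sqrt (globalMaxwellian (0 : EuclideanSpace ℝ (Fin 3))))⁻¹ * Real.exp (‖v‖ ^ 2 / 4) *
          gradRadial 1 x * Real.sqrt (globalMaxwellian (0 : EuclideanSpace ℝ (Fin 3))) :=
        mul_le_mul_of_nonneg_left hM (by positivity [gradRadial_nonneg 1 x])
    _ = Real.exp (‖v‖ ^ 2 / 4) * gradRadial 1 x := by field_simp

/-- `k(v, x) |ψ(v + x)| ≤ C e^{|v|²/4} G(x)` for `|ψ| ≤ C e^{|·|²/4}` in `ℝ³`. [folklore] -/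
theorem carlemanKernel_one_mul_abs_le_of_gaussGrowth {ψ : EuclideanSpace ℝ (Fin 3) → ℝ} {C : ℝ}
    (hC : ∀ x, |ψ x| ≤ C * Real.exp (‖x‖ ^ 2 / 4)) (v x : EuclideanSpace ℝ (Fin 3)) :
    carlemanKernel 1 v x * |ψ (v + x)| ≤ C * Real.exp (‖v‖ ^ 2 / 4) * gradRadial 1 x := by
  have hC0 : 0 ≤ C := by
    have h := hC 0
    rw [norm_zero] at h
    norm_num at h
    exact (abs_nonneg _).trans h
  have h := carlemanKernel_one_le v x
  have h0 : 0 < Real.sqrt (globalMaxwellian (0 : EuclideanSpace ℝ (Fin 3))) :=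
    Real.sqrt_pos.2 (globalMaxwellian_pos 0)
  rw [inv_sqrt_globalMaxwellian v] at h
  have hk0 := carlemanKernel_nonneg 1 v x
  calc carlemanKernel 1 v x * |ψ (v + x)|
      ≤ ((Real.sqrt (globalMaxwellian (0 : EuclideanSpace ℝ (Fin 3))))⁻¹ * Real.exp (‖v‖ ^ 2 / 4) *
          gradRadial 1 x * Real.sqrt (globalMaxwellian (v + x))) * (C * Real.exp (‖v + x‖ ^ 2 / 4)) :=
        mul_le_mul h (hC _) (abs_nonneg _) (by positivity [gradRadial_nonneg 1 x])
    _ = (Real.sqrt (globalMaxwellian (0 : EuclideanSpace ℝ (Fin 3))))⁻¹ * Real.exp (‖v‖ ^ 2 / 4) *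
          gradRadial 1 x * C * (Real.sqrt (globalMaxwellian (v + x)) * Real.exp (‖v + x‖ ^ 2 / 4)) := by
        ring
    _ = C * Real.exp (‖v‖ ^ 2 / 4) * gradRadial 1 x := by
        rw [sqrt_globalMaxwellian_mul_exp]
        field_simp

/-- The Carleman integrand `k(v, x) ψ(v + x)` of a measurable `ψ` of Gaussian growth is integrable,
for every `v` (`G ∈ L¹(ℝ³)`). [folklore] -/
theorem integrable_carlemanKernel_mul_of_gaussGrowth {ψ : EuclideanSpace ℝ (Fin 3) → ℝ}
    (hψ : Measurable ψ) {C : ℝ} (hC : ∀ x, |ψ x| ≤ C * Real.exp (‖x‖ ^ 2 / 4))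
    (v : EuclideanSpace ℝ (Fin 3)) :
    Integrable fun x => carlemanKernel 1 v x * ψ (v + x) := by
  have hG := integrable_gradRadial (d := Fin 3) (β := 1) (by simp) one_pos
  refine (hG.const_mul (C * Real.exp (‖v‖ ^ 2 / 4))).mono'
    (((measurable_carlemanKernel 1).of_uncurry_left.mul (hψ.comp (measurable_const_add v))).aestronglyMeasurable)
    (Eventually.of_forall fun x => ?_)
  rw [Real.norm_eq_abs, abs_mul, abs_of_nonneg (carlemanKernel_nonneg 1 v x)]
  exact carlemanKernel_one_mul_abs_le_of_gaussGrowth hC v x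

/-! ### Continuity of the Carleman gain -/

/-- The Carleman kernel `v ↦ k(v, y - v)` is continuous at `v₀ ≠ y`. [folklore] -/
theorem continuousAt_carlemanKernel_sub {y v₀ : EuclideanSpace ℝ (Fin 3)} (hy : y ≠ v₀) :
    ContinuousAt (fun v : EuclideanSpace ℝ (Fin 3) => carlemanKernel 1 v (y - v)) v₀ := by
  have hne : ‖y - v₀‖ ≠ 0 := norm_ne_zero_iff.2 (sub_ne_zero.2 hy)
  have hsub : ContinuousAt (fun v : EuclideanSpace ℝ (Fin 3) => y - v) v₀ :=
    (continuous_const.sub continuous_id).continuousAt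
  simp only [carlemanKernel]
  refine ContinuousAt.mul ?_ ?_
  · exact (hsub.norm.pow _).inv₀ (pow_ne_zero _ hne)
  · refine (Literature.MathematicalPhysics.KineticTheory.continuous_gaussianPDFReal' 0 _).continuousAt.comp ?_
    exact hsub.norm.add ((continuousAt_id.inner hsub).div hsub.norm hne)

/-- The Carleman gain in the variable `y = v + x`, and the integrability of its integrand.
[folklore] -/
theorem carlemanGain_eq_integral_sub {ψ : EuclideanSpace ℝ (Fin 3) → ℝ} (hψ : Measurable ψ)
    {C : ℝ} (hC : ∀ x, |ψ x| ≤ C * Real.exp (‖x‖ ^ 2 / 4)) (v : EuclideanSpace ℝ (Fin 3)) :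
    carlemanGain 1 ψ v = ∫ y, carlemanKernel 1 v (y - v) * ψ y ∧
      Integrable fun y => carlemanKernel 1 v (y - v) * ψ y := by
  constructor
  · rw [carlemanGain, ← integral_sub_right_eq_self _ v]
    simp only [add_sub_cancel]
  · have := (integrable_carlemanKernel_mul_of_gaussGrowth hψ hC v).comp_sub_right v
    simpa only [add_sub_cancel] using this

/-- **Near part**: for `dist v v₀ < r ≤ 1`,
`|∫_{ball v₀ r} k(v, y - v) ψ(y) dy| ≤ C e^{(|v₀|+1)²/4} ∫_{|u| < 2r} G(u) du`. [folklore] -/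
theorem abs_setIntegral_ball_carleman_le {ψ : EuclideanSpace ℝ (Fin 3) → ℝ} (hψ : Measurable ψ)
    {C : ℝ} (hC : ∀ x, |ψ x| ≤ C * Real.exp (‖x‖ ^ 2 / 4)) {v₀ v : EuclideanSpace ℝ (Fin 3)} {r : ℝ}
    (hr1 : r ≤ 1) (hv : dist v v₀ < r) :
    |∫ y in ball v₀ r, carlemanKernel 1 v (y - v) * ψ y| ≤
      C * Real.exp ((‖v₀‖ + 1) ^ 2 / 4) * ∫ u in ball (0 : EuclideanSpace ℝ (Fin 3)) (2 * r), gradRadial 1 u := by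
  have hC0 : 0 ≤ C := by
    have h := hC 0
    rw [norm_zero] at h
    norm_num at h
    exact (abs_nonneg _).trans h
  set A : ℝ := C * Real.exp ((‖v₀‖ + 1) ^ 2 / 4) with hA
  have hA0 : 0 ≤ A := by positivity
  have hv1 : dist v v₀ < 1 := hv.trans_le hr1
  have hAv : C * Real.exp (‖v‖ ^ 2 / 4) ≤ A := by
    refine mul_le_mul_of_nonneg_left (Real.exp_le_exp.2 ?_) hC0
    have h1 : ‖v‖ ≤ ‖v₀‖ + 1 := by
      have := norm_le_insert' v v₀; rw [← dist_eq_norm] at this; linarith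
    have := pow_le_pow_left₀ (norm_nonneg v) h1 2
    linarith
  have hint := (carlemanGain_eq_integral_sub hψ hC v).2
  have hGv : Integrable fun y : EuclideanSpace ℝ (Fin 3) => gradRadial 1 (y - v) :=
    (integrable_gradRadial (d := Fin 3) (β := 1) (by simp) one_pos).comp_sub_right v
  calc |∫ y in ball v₀ r, carlemanKernel 1 v (y - v) * ψ y|
      ≤ ∫ y in ball v₀ r, |carlemanKernel 1 v (y - v) * ψ y| := abs_integral_le_integral_abs
    _ ≤ ∫ y in ball v₀ r, A * gradRadial 1 (y - v) := by
        refine setIntegral_mono_on hint.norm.integrableOn (hGv.const_mul A).integrableOn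
          measurableSet_ball fun y _ => ?_
        rw [abs_mul, abs_of_nonneg (carlemanKernel_nonneg 1 v _)]
        have h := carlemanKernel_one_mul_abs_le_of_gaussGrowth hC v (y - v)
        rw [add_sub_cancel] at h
        exact h.trans (mul_le_mul_of_nonneg_right hAv (gradRadial_nonneg 1 _))
    _ = A * ∫ y in ball v₀ r, gradRadial 1 (y - v) := integral_const_mul _ _
    _ ≤ A * ∫ y in ball v (2 * r), gradRadial 1 (y - v) := by
        refine mul_le_mul_of_nonneg_left (setIntegral_mono_set hGv.integrableOn
          (Eventually.of_forall fun y => gradRadial_nonneg 1 _) (Eventually.of_forall ?_)) hA0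
        intro y (hy : y ∈ ball v₀ r)
        change y ∈ ball v (2 * r)
        rw [mem_ball] at hy ⊢
        calc dist y v ≤ dist y v₀ + dist v₀ v := dist_triangle _ _ _
          _ < r + r := add_lt_add hy (by rwa [dist_comm])
          _ = 2 * r := by ring
    _ = A * ∫ u in ball (0 : EuclideanSpace ℝ (Fin 3)) (2 * r), gradRadial 1 u := by
        congr 1
        rw [← integral_indicator measurableSet_ball, ← integral_indicator measurableSet_ball,
          ← integral_sub_right_eq_self (fun u => (ball (0 : EuclideanSpace ℝ (Fin 3)) (2 * r)).indicator
            (gradRadial 1) u) v]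
        refine integral_congr_ae (Eventually.of_forall fun y => ?_)
        have hiff : y ∈ ball v (2 * r) ↔ y - v ∈ ball (0 : EuclideanSpace ℝ (Fin 3)) (2 * r) := by
          rw [mem_ball, mem_ball, dist_eq_norm, dist_eq_norm, sub_zero]
        change (ball v (2 * r)).indicator (fun y => gradRadial 1 (y - v)) y =
          (ball (0 : EuclideanSpace ℝ (Fin 3)) (2 * r)).indicator (gradRadial 1) (y - v)
        by_cases hy : y ∈ ball v (2 * r)
        · rw [indicator_of_mem hy, indicator_of_mem (hiff.1 hy)]
        · rw [indicator_of_notMem hy, indicator_of_notMem (fun h => hy (hiff.2 h))]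

/-- **Far part**: `v ↦ ∫_{(ball v₀ r)ᶜ} k(v, y - v) ψ(y) dy` is continuous at `v₀` (dominated convergence:
off `ball v₀ r` and for `dist v v₀ < r/2` the integrand is continuous in `v` and bounded by a fixed
Gaussian, `G(x) ≤ c (2/r) e^{-|x|²/8}` for `|x| ≥ r/2`). [folklore] -/
theorem continuousAt_setIntegral_compl_ball_carleman {ψ : EuclideanSpace ℝ (Fin 3) → ℝ}
    (hψ : Measurable ψ) {C : ℝ} (hC : ∀ x, |ψ x| ≤ C * Real.exp (‖x‖ ^ 2 / 4))
    (v₀ : EuclideanSpace ℝ (Fin 3)) {r : ℝ} (hr0 : 0 < r) (hr1 : r ≤ 1) :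
    ContinuousAt (fun v => ∫ y in (ball v₀ r)ᶜ, carlemanKernel 1 v (y - v) * ψ y) v₀ := by
  have hC0 : 0 ≤ C := by
    have h := hC 0
    rw [norm_zero] at h
    norm_num at h
    exact (abs_nonneg _).trans h
  have hkm : Measurable (Function.uncurry (carlemanKernel (d := Fin 3) 1)) := measurable_carlemanKernel 1
  set A : ℝ := C * Real.exp ((‖v₀‖ + 1) ^ 2 / 4) with hA
  have hA0 : 0 ≤ A := by positivity
  have hAv : ∀ v, dist v v₀ < 1 → C * Real.exp (‖v‖ ^ 2 / 4) ≤ A := by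
    intro v hv
    refine mul_le_mul_of_nonneg_left (Real.exp_le_exp.2 ?_) hC0
    have h1 : ‖v‖ ≤ ‖v₀‖ + 1 := by
      have := norm_le_insert' v v₀; rw [← dist_eq_norm] at this; linarith
    have := pow_le_pow_left₀ (norm_nonneg v) h1 2
    linarith
  set c₁ : ℝ := (Real.sqrt (2 * Real.pi * (1 : ℝ)⁻¹))⁻¹ with hc₁
  have hc₁0 : 0 ≤ c₁ := by positivity
  have hG_apply : ∀ x : EuclideanSpace ℝ (Fin 3), gradRadial 1 x = c₁ * ‖x‖⁻¹ * Real.exp (-(1 / 8) * ‖x‖ ^ 2) := by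
    intro x
    simp only [gradRadial, Fintype.card_fin, show (3 : ℕ) - 2 = 1 from rfl, pow_one, ← hc₁]
  set B₀ : ℝ := A * c₁ * (2 / r) * Real.exp (r ^ 2 / 32) with hB₀
  refine continuousAt_of_dominated (μ := volume.restrict (ball v₀ r)ᶜ)
    (bound := fun y => B₀ * Real.exp (-(1 / 16) * ‖y - v₀‖ ^ 2)) ?_ ?_ ?_ ?_
  · exact Eventually.of_forall fun v =>
      ((hkm.comp (measurable_const.prodMk (measurable_id.sub_const v))).mul hψ).aestronglyMeasurable
  · have hball : ∀ᶠ v in 𝓝 v₀, dist v v₀ < r / 2 := Metric.ball_mem_nhds v₀ (by positivity)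
    filter_upwards [hball] with v hv
    have hv1 : dist v v₀ < 1 := by linarith
    rw [ae_restrict_iff' measurableSet_ball.compl]
    refine Eventually.of_forall fun y hy => ?_
    rw [mem_compl_iff, mem_ball, not_lt] at hy
    have hyv : r / 2 ≤ ‖y - v‖ := by
      have := dist_triangle y v v₀
      rw [dist_eq_norm y v] at this
      linarith
    have hyv0 : 0 < ‖y - v‖ := lt_of_lt_of_le (by positivity) hyv
    rw [Real.norm_eq_abs, abs_mul, abs_of_nonneg (carlemanKernel_nonneg 1 v _)]
    have h := carlemanKernel_one_mul_abs_le_of_gaussGrowth hC v (y - v)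
    rw [add_sub_cancel] at h
    refine h.trans ?_
    rw [hG_apply]
    have hsq : -(1 / 8) * ‖y - v‖ ^ 2 ≤ r ^ 2 / 32 + -(1 / 16) * ‖y - v₀‖ ^ 2 := by
      have h1 : ‖y - v₀‖ ≤ ‖y - v‖ + ‖v - v₀‖ := norm_sub_le_norm_sub_add_norm_sub y v v₀
      have h2 : ‖v - v₀‖ < r / 2 := by rwa [← dist_eq_norm]
      nlinarith [norm_nonneg (y - v₀), norm_nonneg (y - v), norm_nonneg (v - v₀),
        sq_nonneg (‖y - v‖ - ‖v - v₀‖)]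
    have hexp : Real.exp (-(1 / 8) * ‖y - v‖ ^ 2) ≤
        Real.exp (r ^ 2 / 32) * Real.exp (-(1 / 16) * ‖y - v₀‖ ^ 2) := by
      rw [← Real.exp_add]; exact Real.exp_le_exp.2 hsq
    have hinv : ‖y - v‖⁻¹ ≤ 2 / r := by
      rw [inv_le_comm₀ hyv0 (by positivity), inv_div]
      exact hyv
    calc C * Real.exp (‖v‖ ^ 2 / 4) * (c₁ * ‖y - v‖⁻¹ * Real.exp (-(1 / 8) * ‖y - v‖ ^ 2))
        ≤ A * (c₁ * (2 / r) * (Real.exp (r ^ 2 / 32) * Real.exp (-(1 / 16) * ‖y - v₀‖ ^ 2))) := by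
          refine mul_le_mul (hAv v hv1) ?_ (by positivity) hA0
          exact mul_le_mul (mul_le_mul_of_nonneg_left hinv hc₁0) hexp (by positivity) (by positivity)
      _ = B₀ * Real.exp (-(1 / 16) * ‖y - v₀‖ ^ 2) := by rw [hB₀]; ring
  · exact (((integrable_exp_neg_mul_sq_norm (E := EuclideanSpace ℝ (Fin 3)) (b := 1 / 16)
      (by norm_num)).comp_sub_right v₀).const_mul B₀).integrableOn
  · have hnull : (volume : Measure (EuclideanSpace ℝ (Fin 3))) {v₀} = 0 := measure_singleton v₀
    have hae : ∀ᵐ y ∂(volume : Measure (EuclideanSpace ℝ (Fin 3))), y ≠ v₀ := by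
      rw [ae_iff]
      refine measure_mono_null (fun y hy => ?_) hnull
      simp only [ne_eq, not_not, mem_setOf_eq] at hy
      exact hy
    filter_upwards [ae_restrict_of_ae hae] with y hy
    exact (continuousAt_carlemanKernel_sub hy).mul continuousAt_const

/-- **The Carleman gain `v ↦ ∫ k(v, x) ψ(v + x) dx` of a measurable `ψ` of Gaussian growth is
continuous on `ℝ³`.** In the variable `y = v + x` the kernel `k(v, y - v)` has an integrable
singularity `~|y - v|⁻¹` moving with `v`: near `v₀` its contribution is small uniformly
(`abs_setIntegral_ball_carleman_le` with `∫_{|u| < δ} G → 0`, `tendsto_setIntegral_gradRadial`), and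
away from `v₀` dominated convergence applies (`continuousAt_setIntegral_compl_ball_carleman`).
[folklore] -/
theorem continuous_carlemanGain_of_gaussGrowth {ψ : EuclideanSpace ℝ (Fin 3) → ℝ} (hψ : Measurable ψ)
    {C : ℝ} (hC : ∀ x, |ψ x| ≤ C * Real.exp (‖x‖ ^ 2 / 4)) :
    Continuous fun v => carlemanGain 1 ψ v := by
  have hC0 : 0 ≤ C := by
    have h := hC 0
    rw [norm_zero] at h
    norm_num at h
    exact (abs_nonneg _).trans h
  refine continuous_iff_continuousAt.2 fun v₀ => ?_
  rw [Metric.continuousAt_iff]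
  intro ε hε
  set A : ℝ := C * Real.exp ((‖v₀‖ + 1) ^ 2 / 4) with hA
  have hA0 : 0 ≤ A := by positivity
  -- the near radius
  obtain ⟨n, hn⟩ : ∃ n : ℕ, ∫ u in ball (0 : EuclideanSpace ℝ (Fin 3)) (((n : ℝ) + 1)⁻¹), gradRadial 1 u <
      ε / (3 * (A + 1)) :=
    ((tendsto_order.1 (tendsto_setIntegral_gradRadial (d := Fin 3) (β := 1) (by simp) one_pos)).2 _
      (by positivity)).exists
  set r : ℝ := ((n : ℝ) + 1)⁻¹ / 2 with hr
  have hr0 : 0 < r := by positivity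
  have hr1 : r ≤ 1 := by
    rw [hr]
    have : ((n : ℝ) + 1)⁻¹ ≤ 1 := inv_le_one_of_one_le₀ (by linarith [n.cast_nonneg (α := ℝ)])
    linarith
  have h2r : 2 * r = ((n : ℝ) + 1)⁻¹ := by rw [hr]; ring
  have hsmall : A * ∫ u in ball (0 : EuclideanSpace ℝ (Fin 3)) (2 * r), gradRadial 1 u < ε / 3 := by
    rw [h2r]
    have hI : 0 ≤ ∫ u in ball (0 : EuclideanSpace ℝ (Fin 3)) (((n : ℝ) + 1)⁻¹), gradRadial 1 u :=
      setIntegral_nonneg measurableSet_ball fun u _ => gradRadial_nonneg 1 u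
    calc A * ∫ u in ball (0 : EuclideanSpace ℝ (Fin 3)) (((n : ℝ) + 1)⁻¹), gradRadial 1 u
        ≤ (A + 1) * ∫ u in ball (0 : EuclideanSpace ℝ (Fin 3)) (((n : ℝ) + 1)⁻¹), gradRadial 1 u :=
          mul_le_mul_of_nonneg_right (by linarith) hI
      _ < (A + 1) * (ε / (3 * (A + 1))) := mul_lt_mul_of_pos_left hn (by positivity)
      _ = ε / 3 := by field_simp
  -- the far part
  obtain ⟨δ₁, hδ₁, hδ₁'⟩ := Metric.continuousAt_iff.1
    (continuousAt_setIntegral_compl_ball_carleman hψ hC v₀ hr0 hr1) (ε / 3) (by positivity)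
  refine ⟨min δ₁ r, lt_min hδ₁ hr0, fun v hv => ?_⟩
  have hvr : dist v v₀ < r := hv.trans_le (min_le_right _ _)
  have hvδ : dist v v₀ < δ₁ := hv.trans_le (min_le_left _ _)
  have h1 := (abs_setIntegral_ball_carleman_le hψ hC hr1 hvr).trans_lt hsmall
  have h2 := (abs_setIntegral_ball_carleman_le hψ hC hr1 (show dist v₀ v₀ < r by simp [hr0])).trans_lt hsmall
  have h3 := hδ₁' hvδ
  rw [Real.dist_eq] at h3 ⊢
  rw [(carlemanGain_eq_integral_sub hψ hC v).1, (carlemanGain_eq_integral_sub hψ hC v₀).1,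
    ← integral_add_compl measurableSet_ball (carlemanGain_eq_integral_sub hψ hC v).2,
    ← integral_add_compl measurableSet_ball (carlemanGain_eq_integral_sub hψ hC v₀).2]
  have key : ∀ a b c d : ℝ, |a + b - (c + d)| ≤ |a| + |c| + |b - d| := by
    intro a b c d
    calc |a + b - (c + d)| = |a + -c + (b - d)| := by ring_nf
      _ ≤ |a| + |-c| + |b - d| := abs_add_three _ _ _
      _ = |a| + |c| + |b - d| := by rw [abs_neg]
  calc |(∫ y in ball v₀ r, carlemanKernel 1 v (y - v) * ψ y) +
        (∫ y in (ball v₀ r)ᶜ, carlemanKernel 1 v (y - v) * ψ y) -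
        ((∫ y in ball v₀ r, carlemanKernel 1 v₀ (y - v₀) * ψ y) +
          ∫ y in (ball v₀ r)ᶜ, carlemanKernel 1 v₀ (y - v₀) * ψ y)|
      ≤ |∫ y in ball v₀ r, carlemanKernel 1 v (y - v) * ψ y| +
          |∫ y in ball v₀ r, carlemanKernel 1 v₀ (y - v₀) * ψ y| +
          |(∫ y in (ball v₀ r)ᶜ, carlemanKernel 1 v (y - v) * ψ y) -
            ∫ y in (ball v₀ r)ᶜ, carlemanKernel 1 v₀ (y - v₀) * ψ y| := key _ _ _ _
    _ < ε / 3 + ε / 3 + ε / 3 := add_lt_add (add_lt_add h1 h2) h3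
    _ = ε := by ring


end

end Literature.Analysis.UnboundedOperators
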